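import Literature.Computability.Cryptography.LWEPrimePowerProgHist
import Literature.Computability.Cryptography.LWEPrimePowerProgEst
import Literature.Computability.Complexity.GF2KernelProgram
import HarnessLib

/-!
# The Micciancio–Peikert machine, VII: the output on lists (rounding, lifting by `GF(2)` solves, the secret)

Topic `Computability/Cryptography` (LWE), grouping namespace `LWE.MP12.Prog`, sequel of
`LWEPrimePowerProgHist.lean`, using the tree's polynomial-time `GF(2)` kernel test
(`Complexity/GF2KernelProgram.lean`, `progK` / `progKCode`). Proved material (no named fact) towards
`Literature.Computability.Cryptography.blprs_gapSVP_sqrt_dim_to_lwe_classical` (**pqc.S21**),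
hypothesis `h₂`: the output of the solver computed at the list level from the samples and the full
answer history — the selected step `i₀`, the recovered low digits `sLow` (loop states after `e - i₀`
rounds), the rounded top equations `roundMulN`, the divisibility check and the `e - (e - i₀)` lifting
steps (residual bits, the augmented systems `[A | res ; e_c | 1]` fed to `progK`, one solution bit per
coordinate appended to the accumulator's bit lists), and the secret `sLow + 2ᵃ·t` — `outOfL`, with its
polynomial-time realisation on codes **`codeFP_outOfL`**.

## References

* D. Micciancio, C. Peikert, *Trapdoors for lattices: simpler, tighter, faster, smaller*, EUROCRYPT 2012,
  LNCS 7237; full version IACR ePrint 2011/501, §3, Thm. 3.1 proof (p. 16). [MicciancioPeikert2012]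
* S. Arora, B. Barak, *Computational Complexity: A Modern Approach*, CUP 2009, §1.3. [AroraBarak2009]
-/

namespace Literature.Computability.Cryptography

namespace LWE

namespace MP12

namespace Prog

open _root_.Computability Polynomial Literature.Computability.Complexity Literature.Computability.Complexity.CodeFP
  Literature.Computability.Complexity.GF2Kernel

/-! ### Rounding and the top equations -/

/-- Rounding a representative to the nearest multiple of `P`, mod `Q`. [cite: MicciancioPeikert2012, Thm. 3.1 proof (p. 16)] -/
def roundMulN (Q P v : ℕ) : ℕ := (v + P / 2) / P * P % max Q 1

/-- `roundMulN` on codes: context `(Q, (P, v))`. [cite: AroraBarak2009, §1.3] -/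
theorem codeFP_roundMulN : CodeFP (pairE natE (pairE natE natE)) natE (fun p => roundMulN p.1 p.2.1 p.2.2) := by
  have hQ := fst natE (pairE natE natE)
  have hP := (snd natE (pairE natE natE)).fst'
  have hv := (snd natE (pairE natE natE)).snd'
  exact (natMod.comp ((natMul.comp ((natDiv.comp ((natAdd.comp (hv.pair (natDiv.comp (hP.pair (const _ 2))))).pair hP)).pair hP)).pair
    (natMax.comp (hQ.pair (const _ 1))))).congr fun p => by obtain ⟨Q, P, v⟩ := p; rfl

/-- **The rounded top equations** `roundMul 2ᵃ (b - ⟨a, sLow⟩)` of the top items. [cite: MicciancioPeikert2012, Thm. 3.1 proof (p. 16)] -/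
def rValsL (Q P : ℕ) (top : List LItem) (sLow : List ℕ) : List ℕ :=
  top.map fun x => roundMulN Q P ((x.2 + (max Q 1 - dotMod Q x.1 sLow)) % max Q 1)

/-- `rValsL` on codes: context `((Q, P), (top, sLow))`. [cite: AroraBarak2009, §1.3] -/
theorem codeFP_rValsL : CodeFP (pairE (pairE natE natE) (pairE (rawE itemE) (rawE natE))) (rawE natE) (fun p => rValsL p.1.1 p.1.2 p.2.1 p.2.2) := by
  have hitem : CodeFP (pairE (pairE (pairE natE natE) (pairE (rawE itemE) (rawE natE))) itemE) natE
      (fun t => roundMulN t.1.1.1 t.1.1.2 ((t.2.2 + (max t.1.1.1 1 - dotMod t.1.1.1 t.2.1 t.1.2.2)) % max t.1.1.1 1)) := by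
    have hQ := (fst (pairE (pairE natE natE) (pairE (rawE itemE) (rawE natE))) itemE).fst'.fst'
    have hP := (fst (pairE (pairE natE natE) (pairE (rawE itemE) (rawE natE))) itemE).fst'.snd'
    have hsLow := (fst (pairE (pairE natE natE) (pairE (rawE itemE) (rawE natE))) itemE).snd'.snd'
    have hx := snd (pairE (pairE natE natE) (pairE (rawE itemE) (rawE natE))) itemE
    have hQ1 := natMax.comp (hQ.pair (const _ 1))
    have hdot := codeFP_dotMod.comp (hQ.pair (((rawOfList natE).comp hx.fst').pair hsLow))
    exact (codeFP_roundMulN.comp (hQ.pair (hP.pair (natMod.comp ((natAdd.comp (hx.snd'.pair (natSub.comp (hQ1.pair hdot)))).pair hQ1))))).congr fun _ => rfl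
  exact ((map hitem).comp ((CodeFP.id _).pair (snd _ _).fst')).congr fun p => by obtain ⟨⟨Q, P⟩, top, sLow⟩ := p; rfl

/-! ### The `GF(2)` systems of the lifting steps -/

/-- The coefficient rows mod `2`. [folklore] -/
def abitL (top : List LItem) : List (List Bool) := top.map fun x => x.1.map fun v => decide (v % 2 = 1)

/-- `abitL` on codes. [cite: AroraBarak2009, §1.3] -/
theorem codeFP_abitL : CodeFP (rawE itemE) (rawE (rawE bitE)) abitL := by
  have hbit : CodeFP natE bitE (fun v => decide (v % 2 = 1)) := natEq.comp ((natMod.comp ((CodeFP.id natE).pair (const _ 2))).pair (const _ 1))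
  have hrow : CodeFP itemE (rawE bitE) (fun x : LItem => x.1.map fun v => decide (v % 2 = 1)) := (map₀ hbit).comp ((rawOfList natE).comp (fst _ _))
  exact (map₀ hrow).congr fun _ => rfl

/-- The augmented system `[A | b ; e_j | 1]` as rows. [cite: KnuthTAOCP2, §4.6.2, Algorithm N] -/
def augRowsL (A : List (List Bool)) (b : List Bool) (j du : ℕ) : List (List Bool) :=
  List.zipWith (fun row bi => row ++ [bi]) A b ++ [((List.range du).map fun c => decide (c = j)) ++ [true]]

/-- `augRowsL` on codes: context `((A, b), (j, 1ᵈ))`. [cite: AroraBarak2009, §1.3] -/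
theorem codeFP_augRowsL : CodeFP (pairE (pairE (rawE (rawE bitE)) (rawE bitE)) (pairE natE unE)) (rawE (rawE bitE)) (fun p => augRowsL p.1.1 p.1.2 p.2.1 p.2.2) := by
  have hzip := (zipWith (σ := Unit) (eσ := unitE) (g := fun t : Unit × (List Bool × Bool) => t.2.1 ++ [t.2.2])
    ((rawAppend bitE).comp ((snd _ _).fst'.pair ((rawSingleton bitE).comp (snd _ _).snd')))).comp
    ((const _ ()).pair ((fst (pairE (rawE (rawE bitE)) (rawE bitE)) (pairE natE unE)).fst'.pair (fst (pairE (rawE (rawE bitE)) (rawE bitE)) (pairE natE unE)).snd'))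
  have hdu := (snd (pairE (rawE (rawE bitE)) (rawE bitE)) (pairE natE unE)).snd'
  have hj := (snd (pairE (rawE (rawE bitE)) (rawE bitE)) (pairE natE unE)).fst'
  have hpin := (rawAppend bitE).comp (((map (natEq.comp ((snd _ _).pair (fst _ _)))).comp (hj.pair ((rangeOf.comp (hdu.pair (natOfUn.comp hdu))).congr fun p => by
    show List.range (min p.2.2 p.2.2) = List.range p.2.2; rw [min_self]))).pair (const _ [true]))
  exact ((rawAppend (rawE bitE)).comp (hzip.pair ((rawSingleton (rawE bitE)).comp hpin))).congr fun p => by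
    obtain ⟨⟨A, b⟩, j, du⟩ := p; rfl

/-- **The residual bits** of the rows at digit `j` (`P2j = 2ʲ`), given the accumulator `tacc`. [cite: MicciancioPeikert2012, Thm. 3.1 proof (p. 16)] -/
def residL (K P2j : ℕ) (top : List LItem) (r' tacc : List ℕ) : List Bool :=
  List.zipWith (fun (x : LItem) ri => decide (((ri % K + (K - dotMod K x.1 tacc)) % K / max P2j 1) % 2 = 1)) top r'

/-- `residL` on codes: context `((K, P2j), (top, (r', tacc)))`. [cite: AroraBarak2009, §1.3] -/
theorem codeFP_residL : CodeFP (pairE (pairE natE natE) (pairE (rawE itemE) (pairE (rawE natE) (rawE natE)))) (rawE bitE)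
    (fun p => residL p.1.1 p.1.2 p.2.1 p.2.2.1 p.2.2.2) := by
  -- context `((K, P2j), tacc)`, items `(x, ri)`
  have hg : CodeFP (pairE (pairE (pairE natE natE) (rawE natE)) (pairE itemE natE)) bitE
      (fun t => decide (((t.2.2 % t.1.1.1 + (t.1.1.1 - dotMod t.1.1.1 t.2.1.1 t.1.2)) % t.1.1.1 / max t.1.1.2 1) % 2 = 1)) := by
    have hK := (fst (pairE (pairE natE natE) (rawE natE)) (pairE itemE natE)).fst'.fst'
    have hP := (fst (pairE (pairE natE natE) (rawE natE)) (pairE itemE natE)).fst'.snd'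
    have htacc := (fst (pairE (pairE natE natE) (rawE natE)) (pairE itemE natE)).snd'
    have hx := (snd (pairE (pairE natE natE) (rawE natE)) (pairE itemE natE)).fst'
    have hri := (snd (pairE (pairE natE natE) (rawE natE)) (pairE itemE natE)).snd'
    have hdot := codeFP_dotMod.comp (hK.pair (((rawOfList natE).comp hx.fst').pair htacc))
    exact (natEq.comp ((natMod.comp ((natDiv.comp ((natMod.comp ((natAdd.comp ((natMod.comp (hri.pair hK)).pair (natSub.comp (hK.pair hdot)))).pair hK)).pair
      (natMax.comp (hP.pair (const _ 1))))).pair (const _ 2))).pair (const _ 1))).congr fun _ => rfl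
  exact ((zipWith hg).comp (((fst _ _).pair (snd _ _).snd'.snd').pair ((snd _ _).fst'.pair (snd _ _).snd'.fst'))).congr fun p => by
    obtain ⟨⟨K, P2j⟩, top, r', tacc⟩ := p; rfl

/-- **One lifting step on bit lists**: append to each coordinate's bit list its solution bit of the residual system.
[cite: MicciancioPeikert2012, Thm. 3.1 proof (p. 16)] -/
def liftStepL (du K P2j : ℕ) (top : List LItem) (A : List (List Bool)) (r' : List ℕ) (st : List (List Bool)) : List (List Bool) :=
  let tacc := st.map bitsToNat
  let res := residL K P2j top r' tacc
  let sol := (List.range du).map fun c' => progK (augRowsL A res c' du)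
  List.zipWith (fun bl s => bl ++ [s]) st sol

/-- The lifting context `((1ᵈ, (1ᵉ, K)), (top, (A, r')))`. [folklore] -/
abbrev LiftCtx : Type := (ℕ × (ℕ × ℕ)) × (List LItem × (List (List Bool) × List ℕ))

/-- Its code. [folklore] -/
abbrev liftCtxE : LiftCtx → List Bool := pairE (pairE unE (pairE unE natE)) (pairE (rawE itemE) (pairE (rawE (rawE bitE)) (rawE natE)))

/-- `liftStepL` on codes: context `(L, (j, st))` with `P2j = 2^{min j e}`. [cite: AroraBarak2009, §1.3] -/
theorem codeFP_liftStepL : CodeFP (pairE liftCtxE (pairE natE (rawE (rawE bitE)))) (rawE (rawE bitE))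
    (fun t => liftStepL t.1.1.1 t.1.1.2.2 (2 ^ min t.2.1 t.1.1.2.1) t.1.2.1 t.1.2.2.1 t.1.2.2.2 t.2.2) := by
  have hL := fst liftCtxE (pairE natE (rawE (rawE bitE)))
  have hdu := hL.fst'.fst'
  have heu := hL.fst'.snd'.fst'
  have hK := hL.fst'.snd'.snd'
  have htop := hL.snd'.fst'
  have hA := hL.snd'.snd'.fst'
  have hr' := hL.snd'.snd'.snd'
  have hj := (snd liftCtxE (pairE natE (rawE (rawE bitE)))).fst'
  have hst := (snd liftCtxE (pairE natE (rawE (rawE bitE)))).snd'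
  have hP2j := natPow.comp ((const _ 2).pair (unOfNatMin.comp (heu.pair hj)))
  have htacc := (map₀ (strVal.comp bitsToStr)).comp hst
  have hres := codeFP_residL.comp ((hK.pair hP2j).pair (htop.pair (hr'.pair htacc)))
  -- the solution bits: context `((A, res), 1ᵈ)`, item `c'`
  have hsolItem : CodeFP (pairE (pairE (pairE (rawE (rawE bitE)) (rawE bitE)) unE) natE) bitE (fun t => progK (augRowsL t.1.1.1 t.1.1.2 t.2 t.1.2)) :=
    progKCode.comp (codeFP_augRowsL.comp ((fst _ _).fst'.pair ((snd _ _).pair (fst _ _).snd')))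
  have hsol := (map hsolItem).comp (((hA.pair hres).pair hdu).pair ((rangeOf.comp (hdu.pair (natOfUn.comp hdu))).congr fun t => by
    show List.range (min t.1.1.1 t.1.1.1) = List.range t.1.1.1; rw [min_self]))
  have hzip := (zipWith (σ := Unit) (eσ := unitE) (g := fun t : Unit × (List Bool × Bool) => t.2.1 ++ [t.2.2])
    ((rawAppend bitE).comp ((snd _ _).fst'.pair ((rawSingleton bitE).comp (snd _ _).snd')))).comp ((const _ ()).pair (hst.pair hsol))
  exact hzip.congr fun t => by obtain ⟨⟨⟨du, eu, K⟩, top, A, r'⟩, j, st⟩ := t; rfl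

/-! ### The lifting loop -/

/-- **All lifting steps**: fold over the digits `j < steps`, starting from empty bit lists. [cite: MicciancioPeikert2012, Thm. 3.1 proof (p. 16)] -/
def liftAllL (L : LiftCtx) (js : List ℕ) : List (List Bool) :=
  js.foldl (fun st j => liftStepL L.1.1 L.1.2.2 (2 ^ min j L.1.2.1) L.2.1 L.2.2.1 L.2.2.2 st) (List.replicate L.1.1 [])

/-- The shape of the accumulator: `du` bit lists of the same length `k`. [folklore] -/
theorem liftAllL_shape (L : LiftCtx) (js : List ℕ) :
    (liftAllL L js).length = L.1.1 ∧ ∀ bl ∈ liftAllL L js, bl.length = js.length := by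
  unfold liftAllL
  suffices h : ∀ (st : List (List Bool)) (k : ℕ), st.length = L.1.1 → (∀ bl ∈ st, bl.length = k) →
      (js.foldl (fun st j => liftStepL L.1.1 L.1.2.2 (2 ^ min j L.1.2.1) L.2.1 L.2.2.1 L.2.2.2 st) st).length = L.1.1 ∧
        ∀ bl ∈ js.foldl (fun st j => liftStepL L.1.1 L.1.2.2 (2 ^ min j L.1.2.1) L.2.1 L.2.2.1 L.2.2.2 st) st, bl.length = k + js.length by
    simpa using h (List.replicate L.1.1 []) 0 (by simp) (by simp)
  induction js with
  | nil => intro st k h1 h2; exact ⟨h1, by simpa using h2⟩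
  | cons j js ih =>
    intro st k h1 h2
    rw [List.foldl_cons]
    have hlen : (liftStepL L.1.1 L.1.2.2 (2 ^ min j L.1.2.1) L.2.1 L.2.2.1 L.2.2.2 st).length = L.1.1 := by
      simp [liftStepL, List.length_zipWith, h1]
    have hitems : ∀ bl ∈ liftStepL L.1.1 L.1.2.2 (2 ^ min j L.1.2.1) L.2.1 L.2.2.1 L.2.2.2 st, bl.length = k + 1 := by
      intro bl hbl
      simp only [liftStepL] at hbl
      obtain ⟨i, hi, rfl⟩ := List.mem_iff_getElem.1 hbl
      rw [List.getElem_zipWith, List.length_append, List.length_singleton, h2 _ (List.getElem_mem _)]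
    obtain ⟨h3, h4⟩ := ih _ (k + 1) hlen hitems
    exact ⟨h3, fun bl hbl => by rw [h4 bl hbl, List.length_cons]; omega⟩

/-- The code length of the accumulator: `du · (8k + 2)`. [folklore] -/
theorem length_rawE_liftAllL (L : LiftCtx) (js : List ℕ) : (rawE (rawE bitE) (liftAllL L js)).length = L.1.1 * (8 * js.length + 2) := by
  obtain ⟨h1, h2⟩ := liftAllL_shape L js
  rw [length_rawE]
  have h : ∀ bl ∈ liftAllL L js, 2 * (rawE bitE bl).length + 2 = 8 * js.length + 2 := by
    intro bl hbl
    rw [length_rawE]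
    have : (bl.map fun b => 2 * (bitE b).length + 2) = bl.map fun _ => 4 := List.map_congr_left fun b _ => by simp [bitE]
    rw [this, List.map_const', List.sum_replicate, smul_eq_mul, h2 bl hbl]
    ring
  rw [List.map_congr_left h, List.map_const', List.sum_replicate, smul_eq_mul, h1]

/-- **The lifting loop on codes.** [cite: AroraBarak2009, §1.3 (bounded loops)] -/
theorem codeFP_liftAllL : CodeFP (pairE liftCtxE (rawE natE)) (rawE (rawE bitE)) (fun p => liftAllL p.1 p.2) := by
  have hinit : CodeFP liftCtxE (rawE (rawE bitE)) (fun L : LiftCtx => List.replicate L.1.1 ([] : List Bool)) :=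
    (replicateOf (rawE bitE)).comp ((const _ []).pair (fst _ _).fst')
  refine (foldl (step := fun (L : LiftCtx) (j : ℕ) (st : List (List Bool)) => liftStepL L.1.1 L.1.2.2 (2 ^ min j L.1.2.1) L.2.1 L.2.2.1 L.2.2.2 st)
    (init := fun L : LiftCtx => List.replicate L.1.1 []) codeFP_liftStepL hinit (X * (8 * X + 2)) fun L l₁ l₂ => ?_).congr fun p => rfl
  have h := length_rawE_liftAllL L l₁
  unfold liftAllL at h
  rw [h, eval_mul, eval_add, eval_mul, eval_X, eval_ofNat, pairE_apply, length_boolPair]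
  have hdu : L.1.1 ≤ (liftCtxE L).length := by
    obtain ⟨⟨du, eu, K⟩, top, A, r'⟩ := L
    simp only [pairE_apply, length_boolPair, unE]
    have := (unaryEncodeNat du).length_pos_iff
    rw [show (unaryEncodeNat du).length = du from by simp [unaryEncodeNat_eq_replicate]]
    omega
  have hl : l₁.length ≤ (rawE natE (l₁ ++ l₂)).length := ((List.sublist_append_left l₁ l₂).length_le).trans (length_le_length_rawE natE _)
  calc L.1.1 * (8 * l₁.length + 2) ≤ (2 * (liftCtxE L).length + 2 + (rawE natE (l₁ ++ l₂)).length) * (8 * (rawE natE (l₁ ++ l₂)).length + 2) :=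
        Nat.mul_le_mul (by omega) (by omega)
    _ ≤ _ := Nat.mul_le_mul le_rfl (by nlinarith)

/-! ### The top solver and the output -/

/-- **The top solver on lists**: divisibility check, the lifting loop, `2ᵃ·t`. [cite: MicciancioPeikert2012, Thm. 3.1 proof (p. 16)] -/
def topSolveL (Q du eu a e : ℕ) (top : List LItem) (rL : List ℕ) : List ℕ :=
  let P2a := 2 ^ min a eu
  let steps := min (e - a) eu
  if decide (countTrue (rL.map fun v => decide (v % P2a = 0)) = rL.length) then
    (liftAllL ((du, (eu, 2 ^ steps)), (top, (abitL top, rL.map fun v => v / P2a))) (List.range steps)).map fun bl => P2a * bitsToNat bl % max Q 1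
  else List.replicate du 0

/-- The top context `((Q, (1ᵈ, (1ᵉ, (a, e)))), (top, rL))`. [folklore] -/
abbrev topCtxE : (ℕ × (ℕ × (ℕ × (ℕ × ℕ)))) × (List LItem × List ℕ) → List Bool :=
  pairE (pairE natE (pairE unE (pairE unE (pairE natE natE)))) (pairE (rawE itemE) (rawE natE))

/-- `topSolveL` on codes. [cite: AroraBarak2009, §1.3] -/
theorem codeFP_topSolveL : CodeFP topCtxE (rawE natE) (fun p => topSolveL p.1.1 p.1.2.1 p.1.2.2.1 p.1.2.2.2.1 p.1.2.2.2.2 p.2.1 p.2.2) := by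
  have hN := fst (pairE natE (pairE unE (pairE unE (pairE natE natE)))) (pairE (rawE itemE) (rawE natE))
  have hQ := hN.fst'
  have hdu := hN.snd'.fst'
  have heu := hN.snd'.snd'.fst'
  have ha := hN.snd'.snd'.snd'.fst'
  have he := hN.snd'.snd'.snd'.snd'
  have htop := (snd (pairE natE (pairE unE (pairE unE (pairE natE natE)))) (pairE (rawE itemE) (rawE natE))).fst'
  have hrL := (snd (pairE natE (pairE unE (pairE unE (pairE natE natE)))) (pairE (rawE itemE) (rawE natE))).snd'
  have hP2a := natPow.comp ((const _ 2).pair (unOfNatMin.comp (heu.pair ha)))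
  have hstepsU := unOfNatMin.comp (heu.pair (natSub.comp (he.pair ha)))
  have hK := natPow.comp ((const _ 2).pair hstepsU)
  have hcond := natEq.comp ((codeFP_countTrue.comp ((map ((natEq.comp ((natMod.comp ((snd _ _).pair (fst _ _))).pair (const _ 0))))).comp (hP2a.pair hrL))).pair
    ((natLength natE).comp hrL))
  have hr' := (map (natDiv.comp ((snd _ _).pair (fst _ _)))).comp (hP2a.pair hrL)
  have hL := (hdu.pair (heu.pair hK)).pair (htop.pair ((codeFP_abitL.comp htop).pair hr'))
  have hlift := codeFP_liftAllL.comp (hL.pair ((rangeOf.comp (hstepsU.pair (natOfUn.comp hstepsU))).congr fun p => by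
    show List.range (min (min (p.1.2.2.2.2 - p.1.2.2.2.1) p.1.2.2.1) (min (p.1.2.2.2.2 - p.1.2.2.2.1) p.1.2.2.1)) = _; rw [min_self]))
  have hout := (map (natMod.comp ((natMul.comp ((fst _ _).fst'.pair (strVal.comp (bitsToStr.comp (snd _ _))))).pair (natMax.comp ((fst _ _).snd'.pair (const _ 1)))))).comp
    ((hP2a.pair hQ).pair hlift)
  have hzero := (replicateOf natE).comp ((const _ 0).pair hdu)
  exact (hcond.ite hout hzero).congr fun p => by obtain ⟨⟨Q, du, eu, a, e⟩, top, rL⟩ := p; rfl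

/-- The output context `((P, U), (samples, history))` (`U` the unary copies `(1ᵈ, (1ᴷ, (1ᵉ, (1ᵐ, (1ᵀ, (1ᴺ, 1ᴺ'))))))`). [folklore] -/
abbrev OCtx : Type := (PrmT × (ℕ × (ℕ × (ℕ × (ℕ × (ℕ × (ℕ × ℕ))))))) × (List LItem × List Bool)

/-- Its code. [folklore] -/
abbrev oCtxE : OCtx → List Bool := pairE (pairE prmE (pairE unE (pairE unE (pairE unE (pairE unE (pairE unE (pairE unE unE))))))) (pairE (rawE itemE) strE)

/-- **The output on lists**: `sLow + topSolve` on the top samples, and the (empty) trailer of the secret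
code. [cite: MicciancioPeikert2012, Thm. 3.1 proof (p. 16)] -/
def outOfL (z : OCtx) : List ℕ × List Bool :=
  let P := z.1.1
  let U := z.1.2
  let items := z.2.1
  let bits := z.2.2
  let i₀ := stepOfL bits U.2.2.1 U.2.2.2.2.2.2
  let a := P.e - i₀
  let H : HPrm := (P.e, (P.T, (U.2.2.2.2.2.1, (P.G, (P.e + 1) * P.N'))))
  let sLow := (List.range U.1).map fun c => LstateL bits H U.2.2.2.2.1 U.2.2.1 c a
  let top := sliceAt items ((P.e + 1) * (P.N' * (P.m * P.K)) + 2 * (P.d * (P.e * (2 * (P.T * (P.N * (P.m * P.K))))))) P.m'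
  let rL := rValsL P.Q (2 ^ min a U.2.2.1) top sLow
  let FL := topSolveL P.Q U.1 U.2.2.1 a P.e top rL
  (List.zipWith (fun s f => (s + f) % max P.Q 1) sLow FL, [])

/-- **The output on codes.** [cite: AroraBarak2009, §1.3] -/
theorem codeFP_outOfL : CodeFP oCtxE (pairE (listE natE) strE) outOfL := by
  have hP := (fst (pairE prmE (pairE unE (pairE unE (pairE unE (pairE unE (pairE unE (pairE unE unE))))))) (pairE (rawE itemE) strE)).fst'
  have hU := (fst (pairE prmE (pairE unE (pairE unE (pairE unE (pairE unE (pairE unE (pairE unE unE))))))) (pairE (rawE itemE) strE)).snd'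
  have hitems := (snd (pairE prmE (pairE unE (pairE unE (pairE unE (pairE unE (pairE unE (pairE unE unE))))))) (pairE (rawE itemE) strE)).fst'
  have hbits := (snd (pairE prmE (pairE unE (pairE unE (pairE unE (pairE unE (pairE unE (pairE unE unE))))))) (pairE (rawE itemE) strE)).snd'
  have hdu := hU.fst'
  have heu := hU.snd'.snd'.fst'
  have hTu := hU.snd'.snd'.snd'.snd'.fst'
  have hNu := hU.snd'.snd'.snd'.snd'.snd'.fst'
  have hN'u := hU.snd'.snd'.snd'.snd'.snd'.snd'
  have he := codeFP_prm_e.comp hP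
  have hQ := codeFP_prm_Q.comp hP
  have hi₀ := codeFP_stepOfL.comp (hbits.pair (heu.pair hN'u))
  have ha := natSub.comp (he.pair hi₀)
  have hH := he.pair ((codeFP_prm_T.comp hP).pair (hNu.pair ((codeFP_prm_G.comp hP).pair (natMul.comp ((natAdd.comp (he.pair (const _ 1))).pair (codeFP_prm_N'.comp hP))))))
  -- `sLow`: context `z`, item `c`
  have hsItem := codeFP_LstateL.comp ((((hbits.pair hH).comp (fst _ _)).pair (((hTu.comp (fst _ _)).pair ((heu.comp (fst _ _)).pair ((snd _ _).pair (ha.comp (fst oCtxE natE))))))))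
  have hsLow := (map hsItem).comp ((CodeFP.id _).pair ((rangeOf.comp (hdu.pair (natOfUn.comp hdu))).congr fun z => by
    show List.range (min z.1.2.1 z.1.2.1) = _; rw [min_self]))
  have hmK := natMul.comp ((codeFP_prm_m.comp hP).pair (codeFP_prm_K.comp hP))
  have hoff := natAdd.comp ((natMul.comp ((natAdd.comp (he.pair (const _ 1))).pair (natMul.comp ((codeFP_prm_N'.comp hP).pair hmK)))).pair
    (natMul.comp ((const _ 2).pair (natMul.comp ((codeFP_prm_d.comp hP).pair (natMul.comp (he.pair (natMul.comp ((const _ 2).pair (natMul.comp ((codeFP_prm_T.comp hP).pair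
      (natMul.comp ((codeFP_prm_N.comp hP).pair hmK)))))))))))))
  have htop := (codeFP_sliceAt itemE).comp (hitems.pair (hoff.pair (codeFP_prm_m'.comp hP)))
  have hP2a := natPow.comp ((const _ 2).pair (unOfNatMin.comp (heu.pair ha)))
  have hrL := codeFP_rValsL.comp ((hQ.pair hP2a).pair (htop.pair hsLow))
  have hFL := codeFP_topSolveL.comp ((hQ.pair (hdu.pair (heu.pair (ha.pair he)))).pair (htop.pair hrL))
  have hzip := (zipWith (σ := ℕ) (eσ := natE) (g := fun t : ℕ × (ℕ × ℕ) => (t.2.1 + t.2.2) % max t.1 1)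
    (natMod.comp ((natAdd.comp ((snd _ _).fst'.pair (snd _ _).snd')).pair (natMax.comp ((fst _ _).pair (const _ 1)))))).comp (hQ.pair (hsLow.pair hFL))
  exact (((listOfRaw natE).comp hzip).pair (const _ [])).congr fun z => by
    obtain ⟨⟨P, du, Ku, eu, mu, Tu, Nu, N'u⟩, items, bits⟩ := z; rfl

end Prog

end MP12

end LWE

end Literature.Computability.Cryptography
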